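import Summits.ResolutionOfSingularities.ResolutionOfSingularities.Theorems.MarkedTransferCampaignW21MinDegreeTop
import Literature.RingTheory.MvPowerSeries.HasseDerivOrder
import Mathlib.RingTheory.MvPowerSeries.Order
import Mathlib.Data.ZMod.Basic
import HarnessLib

/-!
# [OURS · L1 W2.1] The `e = 0` witness datum: `ε = y x⁴ + y x³ + x⁴ ∈ 𝔽_p⟦y, x⟧` with `q = p⁰ = 1`

Rung L (rescue) of cell res-hironaka, RESCUE-SEED row L-G2, slot W2.1 (hypothesis mining for the Case-(I) order
bound of the diff-product `H♭`), seat res-L1-s21-pv-1. The OURS vocabulary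
`Theorems/MarkedTransferCampaignW21OrderBoundInClass.lean` (res-L1-type-o3, v4 p465799) quantifies its order bounds
over ALL exponents `e : ℕ` of `q = p^e` (binder `(n e ℓ : ℕ)` of `OrderBoundOn`, `LucasBound`, `OrderFormulaCaseI`,
`OrderBoundOpOn`), whereas the manuscript's standing assumption is «q = p^e and ℓ ≫ e > 0» (p.48 L25–L26; Eq. (52)
p.33: `g = y^q + ε`, `ord g = q ≥ p`). At `e = 0` the standard-expression datum of row 052 degenerates (`b = 0`,
`q = 1`, the digit `a_i < p` and the free exponent `c_i` share the base-`p` position 0) and the Lucas selection of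
the surviving monomials of `∂^{(α+pβ)}` (tree: `Literature.RingTheory.MvPowerSeries.le_of_hasseDeriv_monomial_ne_zero`,
hypothesis `0 < e`) is lost.

THIS FILE builds ONE explicit datum at `e = 0` over `K = 𝔽_p`, for EVERY prime `p`: `ε = y x⁴ + y x³ + x⁴` with the
depth-3 standard expression `{(a;b;c)} = {((1,0);0;(0,4)), ((0,1);0;(1,2)), (0;0;(0,4))}`, all coefficients `1`, and
computes its row-054 top frontier (`(α, β) = ((1,0), 0)`, top block `{γ₀ = (0,4)}`, `m = 0`), checks `Standing`
(`u₀ = 1`, `α ≠ 0`, `ord ε = 4 > 1 = q`, `|α + pβ + qγ₀| = 5 < p³`), Case (I) (`|qγ₀| = 4 ≥ 2q = 2`), membership in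
`ShortTopGamma ⊆ LucasClass`, `LongGammas`, `ExactClass`, and the order of the Case-(I) value
`H♭(ε) = ∂^{(1,0)}ε · ∂^{(0,4)}ε = (x⁴ + x³)(y + 1)`: `ord H♭(ε) ≤ 3 < 4 = ord ε`. The refutations drawn from it are in
`MarkedTransferCampaignW21OrderBoundInClassRefutation.lean`. Everything here is OURS / folklore about an OURS datum;
nothing is a statement of or about the manuscript under adjudication (GAP row R05); AI-produced formalisation,
expert review is stronger than AI review.
-/

noncomputable section

set_option linter.dupNamespace false -- mandated namespace of this single-conjunct summit

namespace Summit.ResolutionOfSingularities.ResolutionOfSingularities.Theorems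

namespace CampaignW21

open Literature.AlgebraicGeometry.Hironaka2017.S08UnitMonomial
open Literature.AlgebraicGeometry.Hironaka2017.S09LLUED
open Literature.AlgebraicGeometry.Hironaka2017.S09LLUED.TopFrontier
open Literature.AlgebraicGeometry.Resolution
open Literature.RingTheory.MvPowerSeries
open MvPowerSeries Finsupp
/-! ## The witness datum at `e = 0` over `𝔽_p` -/

namespace ExponentZeroWitness

variable (p : ℕ) [hp : Fact p.Prime]

/-- `R = 𝔽_p⟦X 0, X 1⟧` (`y = X 0`, `x = X 1`). [folklore] -/
abbrev R : Type := MvPowerSeries (Fin 2) (ZMod p)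

/-- The witness `ε = y x⁴ + y x³ + x⁴`. [folklore] -/
def eps : R p := X 0 * X 1 ^ 4 + X 0 * X 1 ^ 3 + X 1 ^ 4

/-- Exponent `(a, b) ↦ y^a x^b` on `Fin 2`. [folklore] -/
abbrev ex (a b : ℕ) : Fin 2 →₀ ℕ := single 0 a + single 1 b

omit hp in
/-- [folklore] -/
theorem ex_apply_zero (a b : ℕ) : ex a b 0 = a := by simp [ex]
omit hp in
/-- [folklore] -/
theorem ex_apply_one (a b : ℕ) : ex a b 1 = b := by simp [ex]

omit hp in
/-- [folklore] -/
theorem ex_eq_iff {a b a' b' : ℕ} : ex a b = ex a' b' ↔ a = a' ∧ b = b' :=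
  ⟨fun h => ⟨by simpa [ex_apply_zero] using DFunLike.congr_fun h 0,
    by simpa [ex_apply_one] using DFunLike.congr_fun h 1⟩, fun h => by rw [h.1, h.2]⟩

omit hp in
/-- [folklore] -/
theorem ex_le_iff {a b a' b' : ℕ} : ex a b ≤ ex a' b' ↔ a ≤ a' ∧ b ≤ b' := by
  rw [Finsupp.le_def]
  constructor
  · intro h; exact ⟨by simpa [ex_apply_zero] using h 0, by simpa [ex_apply_one] using h 1⟩
  · rintro ⟨ha, hb⟩ i
    fin_cases i
    · simpa [ex_apply_zero] using ha
    · simpa [ex_apply_one] using hb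

omit hp in
/-- [folklore] -/
theorem ex_add (a b a' b' : ℕ) : ex a b + ex a' b' = ex (a + a') (b + b') := by
  ext i; fin_cases i <;> simp [ex]
omit hp in
/-- [folklore] -/
theorem ex_degree (a b : ℕ) : (ex a b).degree = a + b := by simp [ex, map_add, degree_single]
omit hp in
/-- [folklore] -/
theorem ex_zero_zero : ex 0 0 = 0 := by simp [ex]

/-- [folklore] -/
theorem X0_eq : (X 0 : R p) = monomial (ex 1 0) 1 := by rw [X_def]; simp [ex]
/-- [folklore] -/
theorem X1_pow_eq (k : ℕ) : (X 1 : R p) ^ k = monomial (ex 0 k) 1 := by rw [X_pow_eq]; simp [ex]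

/-- `ε` as a sum of three monomials. [folklore] -/
theorem eps_eq : eps p = monomial (ex 1 4) 1 + monomial (ex 1 3) 1 + monomial (ex 0 4) 1 := by
  simp only [eps, X1_pow_eq, X0_eq, monomial_mul_monomial, ex_add, mul_one]

/-- Coefficients of `ε`-type monomials. [folklore] -/
theorem coeff_ex_monomial (a b a' b' : ℕ) (c : ZMod p) :
    coeff (ex a b) (monomial (ex a' b') c : R p) = if a = a' ∧ b = b' then c else 0 := by
  classical
  rw [coeff_monomial]
  by_cases h : a = a' ∧ b = b'
  · rw [if_pos (ex_eq_iff.2 h), if_pos h]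
  · rw [if_neg (fun h' => h (ex_eq_iff.1 h')), if_neg h]

/-- Divided derivatives of the monomials `c·y^a x^b` (additive indexing). [folklore] -/
theorem hasseDeriv_ex_monomial_of_le {a b a' b' : ℕ} (ha : a' ≤ a) (hb : b' ≤ b) (c : ZMod p) :
    hasseDeriv (ex a' b') (monomial (ex a b) c : R p) =
      monomial (ex (a - a') (b - b')) (((a.choose a' * b.choose b' : ℕ) : ZMod p) * c) := by
  have hsplit : ex a b = ex a' b' + ex (a - a') (b - b') := by
    rw [ex_add, Nat.add_sub_cancel' ha, Nat.add_sub_cancel' hb]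
  rw [hsplit, hasseDeriv_monomial_add', prod_choose_eq, Fin.prod_univ_two]
  simp only [ex_apply_zero, ex_apply_one, Nat.add_sub_cancel' ha, Nat.add_sub_cancel' hb]

/-- [folklore] -/
theorem hasseDeriv_ex_monomial_of_not_le {a b a' b' : ℕ} (h : ¬ (a' ≤ a ∧ b' ≤ b)) (c : ZMod p) :
    hasseDeriv (ex a' b') (monomial (ex a b) c : R p) = 0 :=
  hasseDeriv_monomial_of_not_le' (fun h' => h (ex_le_iff.1 h')) c

/-- `∂^{(1,0)} ε = x⁴ + x³`. [folklore] -/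
theorem hd_10 : hasseDeriv (ex 1 0) (eps p) = monomial (ex 0 4) 1 + monomial (ex 0 3) 1 := by
  rw [eps_eq, map_add, map_add, hasseDeriv_ex_monomial_of_le p le_rfl (Nat.zero_le 4),
    hasseDeriv_ex_monomial_of_le p le_rfl (Nat.zero_le 3),
    hasseDeriv_ex_monomial_of_not_le p (by omega)]
  simp

/-- `∂^{(0,4)} ε = y + 1`. [folklore] -/
theorem hd_04 : hasseDeriv (ex 0 4) (eps p) = monomial (ex 1 0) 1 + monomial 0 1 := by
  rw [eps_eq, map_add, map_add, hasseDeriv_ex_monomial_of_le p (Nat.zero_le 1) le_rfl,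
    hasseDeriv_ex_monomial_of_not_le p (by omega), hasseDeriv_ex_monomial_of_le p le_rfl le_rfl]
  simp [ex_zero_zero]

/-- The Case-(I) diff-product `∂^{(1,0)}ε · ∂^{(0,4)}ε = y x⁴ + x⁴ + y x³ + x³`. [folklore] -/
theorem hd_prod : hasseDeriv (ex 1 0) (eps p) * hasseDeriv (ex 0 4) (eps p) =
    monomial (ex 1 4) 1 + monomial (ex 0 4) 1 + monomial (ex 1 3) 1 + monomial (ex 0 3) 1 := by
  rw [hd_10, hd_04, ← ex_zero_zero]
  simp only [add_mul, mul_add, monomial_mul_monomial, ex_add, mul_one]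
  abel

/-- `ord (∂^{(1,0)}ε · ∂^{(0,4)}ε) ≤ 3` (the coefficient of `x³` is `1`). [folklore] -/
theorem order_hd_prod_le : (hasseDeriv (ex 1 0) (eps p) * hasseDeriv (ex 0 4) (eps p)).order ≤ ((3 : ℕ) : ℕ∞) := by
  have hc : coeff (ex 0 3) (hasseDeriv (ex 1 0) (eps p) * hasseDeriv (ex 0 4) (eps p)) ≠ 0 := by
    rw [hd_prod, map_add, map_add, map_add, coeff_ex_monomial, coeff_ex_monomial, coeff_ex_monomial,
      coeff_ex_monomial]
    simp
  have := order_le hc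
  rwa [ex_degree] at this

/-- `ord ε = 4`. [folklore] -/
theorem order_eps : (eps p).order = ((4 : ℕ) : ℕ∞) := by
  apply le_antisymm
  · have hc : coeff (ex 0 4) (eps p) ≠ 0 := by
      rw [eps_eq, map_add, map_add, coeff_ex_monomial, coeff_ex_monomial, coeff_ex_monomial]
      simp
    have := order_le hc
    rwa [ex_degree] at this
  · refine MvPowerSeries.le_order fun d hd => ?_
    classical
    have hd' : d.degree < 4 := by exact_mod_cast hd
    rw [eps_eq, map_add, map_add, coeff_monomial, coeff_monomial, coeff_monomial]
    rw [if_neg, if_neg, if_neg, add_zero, add_zero]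
    · rintro rfl; rw [ex_degree] at hd'; omega
    · rintro rfl; rw [ex_degree] at hd'; omega
    · rintro rfl; rw [ex_degree] at hd'; omega

/-- `ord_𝔪 ε = 4` for the tree's `adicOrder`. [folklore] -/
theorem adicOrder_eps : adicOrder (eps p) = ((4 : ℕ) : ℕ∞) := by
  rw [adicOrder_eq_order, order_eps]

/-! ### The standard-expression datum and its top frontier -/

/-- The three index triples `(a; b; c)`. [folklore] -/
def t₁ : ExpTriple 2 := (ex 1 0, 0, ex 0 4)
/-- [folklore] -/
def t₂ : ExpTriple 2 := (ex 0 1, 0, ex 1 2)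
/-- [folklore] -/
def t₃ : ExpTriple 2 := (0, 0, ex 0 4)
/-- The support. [folklore] -/
def T : Finset (ExpTriple 2) := {t₁, t₂, t₃}
/-- The coefficients (all `1`). [folklore] -/
def uu : ExpTriple 2 → R p := fun _ => 1

omit hp in
/-- [folklore] -/
theorem t₁_ne_t₂ : t₁ ≠ t₂ := fun h => by simpa [t₁, t₂, ex_apply_zero] using congrArg (fun t : ExpTriple 2 => t.1 0) h
omit hp in
/-- [folklore] -/
theorem t₁_ne_t₃ : t₁ ≠ t₃ := fun h => by simpa [t₁, t₃, ex_apply_zero] using congrArg (fun t : ExpTriple 2 => t.1 0) h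
omit hp in
/-- [folklore] -/
theorem t₂_ne_t₃ : t₂ ≠ t₃ := fun h => by simpa [t₂, t₃, ex_apply_one] using congrArg (fun t : ExpTriple 2 => t.1 1) h

omit hp in
/-- [folklore] -/
theorem mem_T {t : ExpTriple 2} : t ∈ T ↔ t = t₁ ∨ t = t₂ ∨ t = t₃ := by
  simp [T]

/-- [folklore] -/
theorem effSupport_eq : effSupport T (uu p) = T := by
  ext t; simp [effSupport, uu]

/-- The lexicographic key of the top pair `(α, β) = ((1,0), 0)`. [folklore] -/
def K₁ : Lex (Lex (Fin 2 →₀ ℕ) × Lex (Fin 2 →₀ ℕ)) := toLex (toLex (ex 1 0), toLex 0)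

omit hp in
/-- `(0,1) <lex (1,0)`. [folklore] -/
theorem toLex_ex01_lt : (toLex (ex 0 1) : Lex (Fin 2 →₀ ℕ)) < toLex (ex 1 0) := by
  rw [Finsupp.Lex.lt_iff]
  refine ⟨0, fun j hj => absurd hj (Fin.not_lt_zero j), ?_⟩
  show (ex 0 1) 0 < (ex 1 0) 0
  rw [ex_apply_zero, ex_apply_zero]; exact Nat.zero_lt_one

omit hp in
/-- [folklore] -/
theorem pairKey_le (t : ExpTriple 2) (ht : t ∈ T) : pairKey t ≤ K₁ := by
  rcases mem_T.1 ht with rfl | rfl | rfl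
  · exact le_rfl
  · exact (Prod.Lex.toLex_le_toLex.2 (Or.inl toLex_ex01_lt))
  · exact Prod.Lex.toLex_mono
      ⟨Finsupp.toLex_monotone (show (0 : Fin 2 →₀ ℕ) ≤ ex 1 0 from fun i => Nat.zero_le _), le_rfl⟩

/-- [folklore] -/
theorem topPair_eq : topPair T (uu p) = (ex 1 0, 0) := by
  have h1 : t₁ ∈ effSupport T (uu p) := by rw [effSupport_eq]; exact mem_T.2 (Or.inl rfl)
  have hmax : ∀ h, ((effSupport T (uu p)).image pairKey).max' h = K₁ := fun h =>
    le_antisymm (Finset.max'_le _ _ _ fun k hk => by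
        obtain ⟨t, ht, rfl⟩ := Finset.mem_image.1 hk
        exact pairKey_le t (by rwa [effSupport_eq] at ht))
      (Finset.le_max' _ K₁ ((Finset.mem_image (f := pairKey)).2 ⟨t₁, h1, rfl⟩))
  unfold topPair
  rw [dif_pos ⟨t₁, h1⟩]
  simp only [hmax]
  rfl

/-- `α = (1,0)`. [folklore] -/
theorem alpha_eq : alpha T (uu p) = ex 1 0 := by rw [alpha, topPair_eq]
/-- `β = 0`. [folklore] -/
theorem beta_eq : beta T (uu p) = 0 := by rw [beta, topPair_eq]

/-- The top block is the single term `y x⁴`. [folklore] -/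
theorem topBlock_eq : topBlock T (uu p) = {t₁} := by
  unfold topBlock
  rw [effSupport_eq, alpha_eq, beta_eq]
  ext t
  simp only [Finset.mem_filter, mem_T, Finset.mem_singleton]
  constructor
  · rintro ⟨h | h | h, h1, -⟩
    · exact h
    · exfalso; subst h
      have h' := DFunLike.congr_fun h1 0
      simp [t₂, ex_apply_zero] at h'
    · exfalso; subst h
      have h' := DFunLike.congr_fun h1 0
      simp [t₃, ex_apply_zero] at h'
  · rintro rfl
    exact ⟨Or.inl rfl, rfl, rfl⟩

/-- [folklore] -/
theorem mem_gammaKeys {k : Lex (Fin 2 →₀ ℕ)} : k ∈ gammaKeys T (uu p) ↔ k = toLex (ex 0 4) := by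
  unfold gammaKeys
  rw [topBlock_eq, Finset.image_singleton, Finset.mem_singleton]
  exact Iff.rfl

/-- `m + 1 = 1`. [folklore] -/
theorem frontierLength_eq : frontierLength T (uu p) = 1 := by
  unfold frontierLength gammaKeys
  rw [topBlock_eq, Finset.image_singleton, Finset.card_singleton]

/-- [folklore] -/
theorem frontierLength_pos : 0 < frontierLength T (uu p) := by
  rw [frontierLength_eq]; exact Nat.one_pos

/-- Every top-block exponent is `γ₀ = (0,4)`. [folklore] -/
theorem gamma_eq (j : Fin (frontierLength T (uu p))) : gamma T (uu p) j = ex 0 4 := by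
  have hm := Finset.orderEmbOfFin_mem (gammaKeys T (uu p)) rfl (Fin.rev j)
  rw [mem_gammaKeys] at hm
  show ofLex ((gammaKeys T (uu p)).orderEmbOfFin rfl (Fin.rev j)) = ex 0 4
  rw [hm]; rfl

/-- **The depth-3 standard expression of `ε` with `e = 0`** (`q = p⁰ = 1`; row 052a's datum: `a_i < p`,
`b_j < p^{0−1} = 1`, coefficients `1 = 1^{p³} ∈ ρ³`). [folklore] -/
def stdExpr : StandardExpression p (xs (ZMod p) 2) 0 3 (eps p) where
  support := T
  u := uu p
  u_mem := fun _ _ => ⟨1, one_pow _⟩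
  u_unit_or_zero := fun _ _ => Or.inl isUnit_one
  a_lt := by
    intro t ht i
    have h1 : 1 < p := hp.out.one_lt
    rcases mem_T.1 ht with rfl | rfl | rfl <;> fin_cases i <;>
      simp [t₁, t₂, t₃, ex_apply_zero, ex_apply_one] <;> omega
  b_lt := by
    intro t ht j
    rcases mem_T.1 ht with rfl | rfl | rfl <;> fin_cases j <;> simp [t₁, t₂, t₃]
  sum_eq := by
    rw [T, Finset.sum_insert (by simp [t₁_ne_t₂, t₁_ne_t₃]), Finset.sum_insert (by simp [t₂_ne_t₃]),
      Finset.sum_singleton]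
    simp only [Fin.prod_univ_two, t₁, t₂, t₃, xs, uu, ex_apply_zero, ex_apply_one, Finsupp.coe_zero,
      Pi.zero_apply, mul_zero, pow_zero, one_mul, mul_one, pow_one]
    simp only [eps]
    ring

/-- The `Standing` binders hold for the witness (`u₀ = 1`, `α ≠ 0`, `ord ε = 4 > 1`, `|α+pβ+qγ₀| = 5 < p³`).
[folklore] -/
theorem standing : Standing p 0 3 (eps p) (stdExpr p) (frontierLength_pos p) where
  unit_u0 := isUnit_one
  alpha_ne := by
    intro h
    have h' := DFunLike.congr_fun (show alpha T (uu p) = 0 from h) 0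
    rw [alpha_eq, ex_apply_zero] at h'
    exact one_ne_zero h'
  ord_lt := by
    show ((p ^ 0 : ℕ) : ℕ∞) < adicOrder (eps p)
    rw [pow_zero, adicOrder_eps]
    exact_mod_cast (by norm_num : (1 : ℕ) < 4)
  depth := by
    show (alpha T (uu p) + p • beta T (uu p) + p ^ 0 • gamma T (uu p) ⟨0, frontierLength_pos p⟩).degree < p ^ 3
    rw [alpha_eq, beta_eq, gamma_eq, smul_zero, add_zero, pow_zero, one_smul, ex_add, ex_degree]
    calc 1 + 4 < 2 ^ 3 := by norm_num
      _ ≤ p ^ 3 := Nat.pow_le_pow_left hp.out.two_le 3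

/-- Case (I) of Lem. 9.6 holds for the witness: `|qγ₀| = 4 ≥ 2 = 2q`. [folklore] -/
theorem isCaseI : IsCaseI (p ^ 0) (gamma T (uu p) ⟨0, frontierLength_pos p⟩) := by
  show 2 * p ^ 0 ≤ (p ^ 0 • gamma T (uu p) ⟨0, frontierLength_pos p⟩).degree
  rw [gamma_eq, pow_zero, one_smul, ex_degree]
  norm_num

/-- The witness lies in `ShortTopGamma` (hence in `LucasClass`). [folklore] -/
theorem shortTopGamma : ShortTopGamma p 0 (eps p) (stdExpr p) := by
  intro h0
  show ((p ^ 0 * (gamma T (uu p) ⟨0, h0⟩).degree : ℕ) : ℕ∞) ≤ adicOrder (eps p) ∧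
    ∀ j : Fin (frontierLength T (uu p)), (gamma T (uu p) ⟨0, h0⟩).degree ≤ (gamma T (uu p) j).degree
  refine ⟨?_, fun j => by rw [gamma_eq, gamma_eq]⟩
  rw [gamma_eq, adicOrder_eps, pow_zero, one_mul, ex_degree]

/-- The witness lies in `LucasClass`. [folklore] -/
theorem lucasClass : LucasClass p 0 (eps p) (stdExpr p) := Or.inr (shortTopGamma p)

/-- The witness lies in `LongGammas` (`ord ε = 4 = q|γ₀|`). [folklore] -/
theorem longGammas : LongGammas p 0 (eps p) (stdExpr p) := by
  intro j
  show adicOrder (eps p) ≤ ((p ^ 0 * (gamma T (uu p) j).degree : ℕ) : ℕ∞)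
  rw [gamma_eq, adicOrder_eps, pow_zero, one_mul, ex_degree]

/-- Every effective term has total degree `≥ 4`. [folklore] -/
theorem four_le_degree_of_mem {t : ExpTriple 2} (ht : t ∈ effSupport T (uu p)) :
    4 ≤ (t.1 + p • t.2.1 + p ^ 0 • t.2.2).degree := by
  rw [effSupport_eq] at ht
  rcases mem_T.1 ht with rfl | rfl | rfl <;>
    simp [t₁, t₂, t₃, ex_add, map_add, degree_single]

/-- The witness lies in `ExactClass`. [folklore] -/
theorem exactClass : ExactClass p 0 (eps p) (stdExpr p) := by
  intro h0 j t ht _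
  show adicOrder (eps p) + ((p ^ 0 * (gamma T (uu p) ⟨0, h0⟩).degree : ℕ) : ℕ∞) ≤
    ((p ^ 0 * (gamma T (uu p) j).degree + (t.1 + p • t.2.1 + p ^ 0 • t.2.2).degree : ℕ) : ℕ∞)
  have h4 := four_le_degree_of_mem p ht
  generalize (t.1 + p • t.2.1 + p ^ 0 • t.2.2).degree = N at h4 ⊢
  rw [gamma_eq, gamma_eq, adicOrder_eps, ← Nat.cast_add, Nat.cast_le, pow_zero, one_mul, ex_degree]
  omega

/-- The Case-(I) value `H♭(ε)` of the witness is `∂^{(1,0)}ε · ∂^{(0,4)}ε` (the leading unit is `1`).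
[folklore] -/
theorem caseI_eq (u : (R p)ˣ) (hu : (u : R p) = 1) :
    HFlat.caseI (hasseD (ZMod p) 2) u p (p ^ 0) (alpha T (uu p)) (beta T (uu p))
        (gamma T (uu p) ⟨0, frontierLength_pos p⟩) (eps p) =
      hasseDeriv (ex 1 0) (eps p) * hasseDeriv (ex 0 4) (eps p) := by
  obtain rfl : u = 1 := Units.ext (by simpa using hu)
  show (↑(1 : (R p)ˣ)⁻¹ : R p) * hasseDeriv (alpha T (uu p) + p • beta T (uu p)) (eps p) *
      hasseDeriv (p ^ 0 • gamma T (uu p) ⟨0, frontierLength_pos p⟩) (eps p) = _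
  rw [inv_one, Units.val_one, one_mul, alpha_eq, beta_eq, gamma_eq, smul_zero, add_zero, pow_zero, one_smul]

/-- `ord H♭(ε) ≤ 3 < 4 = ord ε` for the witness. [folklore] -/
theorem adicOrder_caseI_le (u : (R p)ˣ) (hu : (u : R p) = 1) :
    adicOrder (HFlat.caseI (hasseD (ZMod p) 2) u p (p ^ 0) (alpha T (uu p)) (beta T (uu p))
        (gamma T (uu p) ⟨0, frontierLength_pos p⟩) (eps p)) ≤ ((3 : ℕ) : ℕ∞) := by
  rw [caseI_eq p u hu, adicOrder_eq_order]
  exact order_hd_prod_le p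

/-- The unit packaged by `Standing.unit_u0` is `1`. [folklore] -/
theorem standing_unit_eq : ((standing p).unit_u0.unit : R p) = 1 := IsUnit.unit_spec _

end ExponentZeroWitness

end CampaignW21

end Summit.ResolutionOfSingularities.ResolutionOfSingularities.Theorems

end
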